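import Mathlib
import HarnessLib
import Summits.CriticalPhenomena.CardyFormulaZ2.Theorems.CardyMagicRigidityMagicFormulaTLatticeReflection
import Summits.CriticalPhenomena.CardyFormulaZ2.Theorems.CardyMagicRigidityMagicFormulaTLoopReflection
import Summits.CriticalPhenomena.CardyFormulaZ2.Theorems.CardyMagicRigidityMagicFormulaTStubDilation
import Summits.CriticalPhenomena.CardyFormulaZ2.Theorems.CardyMagicRigidityTransferContinuityReduction
import Literature.Probability.RandomPlanarGeometry.NestingTransform

/-!
# The complex-coupling nesting transform of an odd density is even (crux `MagicFormulaT`)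

Crux `Summit.CriticalPhenomena.CardyFormulaZ2.Theses.CardyMagicRigidity.MagicFormulaT`
(stmt-CriticalPhenomena-4836), line `Sketch`, sub-goal `cNesting_even_of_oddDensity`.

The complex-coupling transform at mesh `δ` of a density `f : ℂ → ℝ` is
`Φ_δ(t) = E_{1/2}[∏_u 2cos(t θ_u(f) + π/3)]`, `u` over the honeycomb interface loops
`(siteLoopConfig δ ω).loops` of critical site percolation on `δ𝕋`, `θ_u(f) = ∫_{W(u,·) ≠ 0} f`
(`UnbasedLoop.nestingPhase`). **Theorem (`cNesting_even_of_oddDensity`).** If `f` is odd under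
the point reflection `z ↦ −z`, then `Φ_δ(−t) = Φ_δ(t)` for every mesh `δ > 0` and every `t : ℂ`
(so all odd Taylor coefficients of `Φ_δ` vanish EXACTLY on the odd sector, at every mesh).

Proof.
* Mesh `δ` → mesh `1` (`ode_integral_finprod_dilate`, the complex-weight form of
  `finprod_loopWeight_dilate`): the loops at mesh `δ` are the `δ`-dilates of the loops at mesh `1`
  (`loopSet_eq_image`, `imageOn_mul_injective`), and `θ_{δu}(f) = θ_u(f_δ)` with the dilated
  density `f_δ(z) = δ² f(δz)` (`setOf_wind_imageOn_mul_ne_zero`, `setIntegral_smul_set_eq`),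
  which is odd again (`ode_odd_dilate`).
* Reflection at mesh `1` through the origin `triEmbed 0 = 0`: the loops of the reflected
  configuration `(Equiv.subLeft 0) '' ω` are the reflected loops (`loops_siteLoopConfig_reflect`,
  injective by `imageOn_reflect_injective`), winding numbers are reflection invariant
  (`wind_imageOn_reflect`), so `{W(−u, ·) ≠ 0} = −{W(u, ·) ≠ 0}` and, Lebesgue measure on `ℂ` being
  invariant under `z ↦ p − z`, `θ_{p−u}(g) = θ_u(g(p − ·))` (`ode_nestingPhase_imageOn_reflect`);
  for odd `g` and `p = 0` this is `−θ_u(g)`, and `cos(−t(−θ) + π/3) = cos(tθ + π/3)`.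
* The reflection `ω ↦ (Equiv.subLeft 0) '' ω` preserves `P_{1/2}` (`measurePreserving_reflect`),
  and the change of variables `MeasurePreserving.integral_comp'` finishes.

No definition is introduced; everything is proved from tree / Mathlib material; no named fact is
used.
-/

noncomputable section

namespace Summit.CriticalPhenomena.CardyFormulaZ2.Cruxes.MagicFormulaT.LineSketch

open MeasureTheory Filter Set
open scoped Real Topology BigOperators ENNReal
open Literature.Probability.RandomPlanarGeometry Literature.Probability.Percolation
  Literature.Probability.LatticeModels
open Summit.CriticalPhenomena.CardyFormulaZ2.Theorems (loops_siteLoopConfig)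

/-! ## Mesh `δ` → mesh `1`: the phase and the product under dilation -/

/-- **The phase of a dilated loop is the phase of the dilated density**:
`θ_{δu}(f) = θ_u(f_δ)`, `f_δ(z) = δ² f(δz)`, for `δ > 0` (junk values included). -/
theorem ode_nestingPhase_imageOn_mul (f : ℂ → ℝ) {δ : ℝ} (hδ : 0 < δ) (u : UnbasedLoop ℂ) :
    (UnbasedLoop.imageOn (fun z ↦ (δ : ℂ) * z) univ u).nestingPhase f =
      u.nestingPhase (fun z ↦ δ ^ 2 * f ((δ : ℂ) * z)) := by
  change (∫ z in {z | (UnbasedLoop.imageOn (fun z ↦ (δ : ℂ) * z) univ u).wind z ≠ 0}, f z) =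
    ∫ z in {z | u.wind z ≠ 0}, δ ^ 2 * f ((δ : ℂ) * z)
  rw [setOf_wind_imageOn_mul_ne_zero hδ u, setIntegral_smul_set_eq f hδ]

/-- **The dilation identity for a general weight of the phase**: for every `F : ℝ → ℂ`,
`∫ ∏_{u loop of δ𝕋} F(θ_u(f)) dP = ∫ ∏_{u loop of 𝕋} F(θ_u(f_δ)) dP` (configuration by
configuration: the loops at mesh `δ` are the injective image of those at mesh `1` under the
dilation of unbased loops). -/
theorem ode_integral_finprod_dilate (F : ℝ → ℂ) (f : ℂ → ℝ) {δ : ℝ} (hδ : 0 < δ)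
    (P : Measure (SiteConfig (Site 2))) :
    ∫ ω, (∏ᶠ u ∈ (siteLoopConfig δ ω).loops, F (u.nestingPhase f)) ∂P =
      ∫ ω, (∏ᶠ u ∈ (siteLoopConfig 1 ω).loops,
        F (u.nestingPhase (fun z ↦ δ ^ 2 * f ((δ : ℂ) * z)))) ∂P := by
  refine integral_congr_ae (Eventually.of_forall fun ω ↦ ?_)
  change (∏ᶠ u ∈ (siteLoopConfig δ ω).loops, F (u.nestingPhase f)) =
    ∏ᶠ u ∈ (siteLoopConfig 1 ω).loops, F (u.nestingPhase (fun z ↦ δ ^ 2 * f ((δ : ℂ) * z)))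
  rw [loops_siteLoopConfig δ ω, loops_siteLoopConfig 1 ω, loopSet_eq_image δ ω,
    finprod_mem_image (imageOn_mul_injective hδ.ne').injOn]
  exact finprod_mem_congr rfl fun u _ ↦ by rw [ode_nestingPhase_imageOn_mul f hδ u]

/-- The dilated density of an odd density is odd. -/
theorem ode_odd_dilate (f : ℂ → ℝ) (hf : ∀ z, f (-z) = -f z) (δ : ℝ) (z : ℂ) :
    (fun z ↦ δ ^ 2 * f ((δ : ℂ) * z)) (-z) = -(fun z ↦ δ ^ 2 * f ((δ : ℂ) * z)) z := by
  simp only [mul_neg, hf]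

/-! ## Mesh `1`: the phase under the point reflection `z ↦ p − z` -/

/-- **Interiors reflect**: `{W(p − u, ·) ≠ 0} = p − {W(u, ·) ≠ 0}` (winding numbers are
reflection invariant, junk values included, and the reflection is an involution). -/
theorem ode_setOf_wind_imageOn_reflect_ne_zero (p : ℂ) (u : UnbasedLoop ℂ) :
    {z : ℂ | (UnbasedLoop.imageOn (fun z ↦ p - z) univ u).wind z ≠ 0} =
      (fun w ↦ p - w) '' {w : ℂ | u.wind w ≠ 0} := by
  ext z
  constructor
  · intro hz
    refine ⟨p - z, ?_, sub_sub_cancel p z⟩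
    rw [mem_setOf_eq, ← wind_imageOn_reflect p u (p - z), sub_sub_cancel]
    exact hz
  · rintro ⟨w, hw, rfl⟩
    rw [mem_setOf_eq, wind_imageOn_reflect]
    exact hw

/-- **The phase of a reflected loop is the phase of the reflected density**:
`θ_{p−u}(g) = θ_u(g(p − ·))` (Lebesgue measure on `ℂ` is invariant under `z ↦ p − z`; junk values
included). -/
theorem ode_nestingPhase_imageOn_reflect (g : ℂ → ℝ) (p : ℂ) (u : UnbasedLoop ℂ) :
    (UnbasedLoop.imageOn (fun z ↦ p - z) univ u).nestingPhase g =
      u.nestingPhase (fun w ↦ g (p - w)) := by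
  change (∫ z in {z | (UnbasedLoop.imageOn (fun z ↦ p - z) univ u).wind z ≠ 0}, g z) =
    ∫ w in {w | u.wind w ≠ 0}, g (p - w)
  rw [ode_setOf_wind_imageOn_reflect_ne_zero p u]
  exact (Measure.measurePreserving_sub_left volume p).setIntegral_image_emb
    (MeasurableEquiv.subLeft p).measurableEmbedding g _

/-- **For an odd density, the reflection through the origin negates the phase**:
`θ_{−u}(g) = −θ_u(g)` (the origin is the half-lattice point `triEmbed 0`). -/
theorem ode_nestingPhase_imageOn_reflect_zero_of_odd (g : ℂ → ℝ) (hg : ∀ z, g (-z) = -g z)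
    (u : UnbasedLoop ℂ) :
    (UnbasedLoop.imageOn (fun z ↦ triEmbed (0 : Site 2) - z) univ u).nestingPhase g =
      -u.nestingPhase g := by
  rw [ode_nestingPhase_imageOn_reflect]
  simp only [triEmbed_zero, zero_sub, hg]
  exact integral_neg g

/-- **The product over the loops of the reflected configuration** (mesh `1`, reflection through
the origin, odd density): for every weight `F : ℝ → ℂ`,
`∏_{u loop of (0 − ·) '' ω} F(θ_u(g)) = ∏_{u loop of ω} F(−θ_u(g))`. -/
theorem ode_finprod_loops_reflect_zero_of_odd (F : ℝ → ℂ) (g : ℂ → ℝ) (hg : ∀ z, g (-z) = -g z)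
    (ω : SiteConfig (Site 2)) :
    ∏ᶠ u ∈ (siteLoopConfig 1 ((Equiv.subLeft (0 : Site 2)) '' ω)).loops, F (u.nestingPhase g) =
      ∏ᶠ u ∈ (siteLoopConfig 1 ω).loops, F (-u.nestingPhase g) := by
  rw [loops_siteLoopConfig_reflect (0 : Site 2) ω,
    finprod_mem_image (imageOn_reflect_injective _).injOn]
  exact finprod_mem_congr rfl fun u _ ↦ by
    rw [ode_nestingPhase_imageOn_reflect_zero_of_odd g hg u]

/-- `2cos(−t(−θ) + π/3) = 2cos(tθ + π/3)`. -/
theorem ode_cos_neg_mul_neg (t : ℂ) (θ : ℝ) :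
    2 * Complex.cos (-t * (((-θ : ℝ)) : ℂ) + (Real.pi : ℂ) / 3) =
      2 * Complex.cos (t * ((θ : ℝ) : ℂ) + (Real.pi : ℂ) / 3) := by
  rw [Complex.ofReal_neg, neg_mul_neg]

/-- **Evenness at mesh `1`**: for an odd density `g`, `Φ_1(−t) = Φ_1(t)` (reflect the
configuration through the origin: the loops reflect, the phases change sign, `P_{1/2}` is
preserved). -/
theorem ode_integral_finprod_one_even (g : ℂ → ℝ) (hg : ∀ z, g (-z) = -g z) (t : ℂ) :
    (∫ ω, (∏ᶠ u ∈ (siteLoopConfig 1 ω).loops,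
      2 * Complex.cos (-t * ((u.nestingPhase g : ℝ) : ℂ) + (Real.pi : ℂ) / 3))
        ∂(triSitePercolation half)) =
    ∫ ω, (∏ᶠ u ∈ (siteLoopConfig 1 ω).loops,
      2 * Complex.cos (t * ((u.nestingPhase g : ℝ) : ℂ) + (Real.pi : ℂ) / 3))
        ∂(triSitePercolation half) := by
  rw [← (measurePreserving_reflect (0 : Site 2) half).integral_comp'
    (fun ω ↦ ∏ᶠ u ∈ (siteLoopConfig 1 ω).loops,
      2 * Complex.cos (-t * ((u.nestingPhase g : ℝ) : ℂ) + (Real.pi : ℂ) / 3))]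
  refine integral_congr_ae (Eventually.of_forall fun ω ↦ ?_)
  change (∏ᶠ u ∈ (siteLoopConfig 1 ((Equiv.subLeft (0 : Site 2)) '' ω)).loops,
      2 * Complex.cos (-t * ((u.nestingPhase g : ℝ) : ℂ) + (Real.pi : ℂ) / 3)) =
    ∏ᶠ u ∈ (siteLoopConfig 1 ω).loops,
      2 * Complex.cos (t * ((u.nestingPhase g : ℝ) : ℂ) + (Real.pi : ℂ) / 3)
  rw [ode_finprod_loops_reflect_zero_of_odd
    (fun θ ↦ 2 * Complex.cos (-t * ((θ : ℝ) : ℂ) + (Real.pi : ℂ) / 3)) g hg ω]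
  exact finprod_mem_congr rfl fun u _ ↦ ode_cos_neg_mul_neg t (u.nestingPhase g)

/-! ## The stub -/

/-- **Sub-goal `cNesting_even_of_oddDensity` of line `Sketch` (crux `MagicFormulaT`).** For a
density `f : ℂ → ℝ` odd under `z ↦ −z`, the complex-coupling nesting transform of critical site
percolation on `δ𝕋` is even in the coupling at EVERY mesh `δ > 0`:
`E_{1/2}[∏_u 2cos(−t θ_u(f) + π/3)] = E_{1/2}[∏_u 2cos(t θ_u(f) + π/3)]`, `u` over the honeycomb
interface loops, `θ_u(f) = ∫_{W(u,·) ≠ 0} f`. Proof: dilate to mesh `1` (the dilated density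
`δ² f(δ ·)` is odd), reflect the configuration through the origin (a symmetry of `𝕋`, of its
interface loops, of winding numbers and of `P_{1/2}`), under which every phase changes sign. -/
theorem cNesting_even_of_oddDensity : ∀ (f : ℂ → ℝ), (∀ z, f (-z) = -f z) → ∀ δ : ℝ, 0 < δ →
    ∀ t : ℂ,
    (∫ ω, (∏ᶠ u ∈ (siteLoopConfig δ ω).loops,
      2 * Complex.cos (-t * ((u.nestingPhase f : ℝ) : ℂ) + (Real.pi : ℂ) / 3))
        ∂(triSitePercolation half)) =
    ∫ ω, (∏ᶠ u ∈ (siteLoopConfig δ ω).loops,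
      2 * Complex.cos (t * ((u.nestingPhase f : ℝ) : ℂ) + (Real.pi : ℂ) / 3))
        ∂(triSitePercolation half) := by
  intro f hf δ hδ t
  rw [ode_integral_finprod_dilate (fun θ ↦ 2 * Complex.cos (-t * ((θ : ℝ) : ℂ) + (Real.pi : ℂ) / 3))
      f hδ,
    ode_integral_finprod_dilate (fun θ ↦ 2 * Complex.cos (t * ((θ : ℝ) : ℂ) + (Real.pi : ℂ) / 3))
      f hδ]
  exact ode_integral_finprod_one_even _ (ode_odd_dilate f hf δ) t

end Summit.CriticalPhenomena.CardyFormulaZ2.Cruxes.MagicFormulaT.LineSketch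

end
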